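import Mathlib
import Literature.MathematicalPhysics.StatisticalMechanics.BarlowStacking
import Summits.AtomisticToContinuum.Crystallization.Theorems.NashClassCertificatesNashNearFieldStubSmoothRegimeCoercivity

/-!
# Route `NashClassCertificates`, crux `NashNearField` (stmt-AtomisticToContinuum-16827), line `birth`:
# pieces for the stub `stub_localSmoothCertificateOfCauchyBorn` (CBBC ⇒ LSC), I — the sitewise Cauchy–Born
# expansion with exact first-order transfer

The local smooth certificate LSC (hypothesis of the landed `stub_bsmoothOfLocalSmoothCertificate`) asks for an
antisymmetric, `r⁻⁶`-dominated transfer `τ` making the calibrated partial site excess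
`(½ Σ_{j∈Ω∖i} V(|x i − x j|) − e*) + Σ_{j∈Ω} τ i j` bounded below sitewise.  Its first layer is pure algebra plus
the landed one-bond Taylor bound `stub_ljPairTaylor`, and is landed here for an arbitrary REFERENCE `y` with
displacement `u = x − y`:

* the Lennard-Jones bond gradient `k(v) = (−‖v‖⁻¹⁴ + ‖v‖⁻⁸)·v = V′(‖v‖) v/‖v‖` (written inline; odd, `k 0 = 0`);
* `stub_transferAntisymm` — for ANY odd `k`, the transfer `τ i j = ½⟪k(y i − y j), u i + u j⟫` is antisymmetric;
* `stub_linAddTransfer` — the EXACT first-order identity: `Lin_i + Σ_{j∈Ω} τ i j = ⟪F_i, u i⟫` with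
  `Lin_i = ½ Σ_{j∈Ω∖i} ⟪k(y i − y j), u i − u j⟫` (first variation of the partial site energy) and
  `F_i = Σ_{j∈Ω∖i} k(y i − y j)` (the reference bond-force sum at `i`): the first-order terms are carried away
  exactly by `τ`, up to the force imbalance of the REFERENCE at `i` (zero for centrosymmetric reference shells,
  `stub_oddShellSum`);
* `stub_siteExpansionRemainder` — `|e_i(x) − e_i(y) − Lin_i| ≤ ½ Σ_{j∈Ω∖i} ‖u i − u j‖²(7281‖y i − y j‖⁻¹⁴ + 521‖y i − y j‖⁻⁸)`
  whenever `‖u i − u j‖ ≤ ‖y i − y j‖/4` on `Ω ∖ i` (sum of `stub_ljPairTaylor` over the bonds);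
* `stub_calibratedSiteExpansion` — combining: `e_i(x) + Σ_{j∈Ω} τ i j ≥ e_i(y) + ⟪F_i, u i⟫ − ½ Σ ‖u i − u j‖²(…)`,
  the sitewise Cauchy–Born expansion with exact first-order cancellation;
* `stub_transferEnvelope` — `|τ i j| ≤ ½ (‖y i − y j‖⁻¹³ + ‖y i − y j‖⁻⁷)(‖u i‖ + ‖u j‖)` (so a bounded gauge `u`
  and reference bonds comparable to the actual ones give the `M·r⁻⁶` envelope of LSC);
* `stub_oddShellSum` — an odd vector function sums to zero over a finite set closed under `p ↦ −p`
  (force balance `F_i = 0` of centrosymmetric reference shells, e.g. any linear image of a truncated fcc template).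

All `[folklore]`; `e_i(z) := ½ Σ_{j∈Ω∖i} V_LJ(‖z i − z j‖)`.
-/

noncomputable section

open scoped BigOperators RealInnerProductSpace
open Literature.MathematicalPhysics.StatisticalMechanics

namespace Summit.AtomisticToContinuum.Crystallization.Theorems.NashClassCertificatesNashNearField

/-- An odd vector function vanishes at the origin. [folklore] -/
theorem odd_apply_zero {k : EuclideanSpace ℝ (Fin 3) → EuclideanSpace ℝ (Fin 3)} (hk : ∀ v, k (-v) = -k v) :
    k 0 = 0 := by
  have h := hk 0
  rw [neg_zero] at h
  have h2 : (2 : ℝ) • k 0 = 0 := by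
    rw [two_smul]
    nth_rewrite 2 [h]
    exact add_neg_cancel (k 0)
  exact (smul_eq_zero.1 h2).resolve_left two_ne_zero

/-- **Stub piece `stub_transferAntisymm` (proved).**  For an odd bond map `k` (e.g. the Lennard-Jones bond gradient),
a reference `y` and a displacement `u`, the first-order transfer `τ i j = ½⟪k(y i − y j), u i + u j⟫` is
antisymmetric. [folklore] -/
theorem stub_transferAntisymm :
    ∀ (N : ℕ) (k : EuclideanSpace ℝ (Fin 3) → EuclideanSpace ℝ (Fin 3)), (∀ v, k (-v) = -k v) →
      ∀ (y u : Fin N → EuclideanSpace ℝ (Fin 3)) (i j : Fin N),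
        (1 / 2 : ℝ) * inner ℝ (k (y i - y j)) (u i + u j) = -((1 / 2 : ℝ) * inner ℝ (k (y j - y i)) (u j + u i)) := by
  intro N k hk y u i j
  rw [show y j - y i = -(y i - y j) by abel, hk, inner_neg_left, add_comm (u j) (u i)]
  ring

/-- **Stub piece `stub_linAddTransfer`: the exact first-order transfer identity (proved).**  For an odd bond map `k`,
a finite region `Ω ∋ i`, a reference `y` and a displacement `u`:
`½ Σ_{j∈Ω∖i} ⟪k(y i − y j), u i − u j⟫ + Σ_{j∈Ω} ½⟪k(y i − y j), u i + u j⟫ = ⟪Σ_{j∈Ω∖i} k(y i − y j), u i⟫` — the first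
variation of the partial site energy plus the outgoing transfers equals the work of the REFERENCE bond-force sum at
`i` against `u i` (the `j = i` transfer vanishes because `k 0 = 0`).  For a reference in force balance at `i` the
right-hand side is zero: the first-order terms cancel exactly. [folklore] -/
theorem stub_linAddTransfer :
    ∀ (N : ℕ) (k : EuclideanSpace ℝ (Fin 3) → EuclideanSpace ℝ (Fin 3)), (∀ v, k (-v) = -k v) →
      ∀ (Ω : Finset (Fin N)) (y u : Fin N → EuclideanSpace ℝ (Fin 3)) (i : Fin N), i ∈ Ω →
        (1 / 2 : ℝ) * (∑ j ∈ Ω.erase i, inner ℝ (k (y i - y j)) (u i - u j)) +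
            ∑ j ∈ Ω, (1 / 2 : ℝ) * inner ℝ (k (y i - y j)) (u i + u j) =
          inner ℝ (∑ j ∈ Ω.erase i, k (y i - y j)) (u i) := by
  intro N k hk Ω y u i hi
  have hk0 : k 0 = 0 := odd_apply_zero hk
  rw [← Finset.add_sum_erase Ω _ hi, sub_self, hk0, inner_zero_left, mul_zero, zero_add, Finset.mul_sum,
    ← Finset.sum_add_distrib, sum_inner]
  refine Finset.sum_congr rfl fun j _ => ?_
  rw [inner_sub_right, inner_add_right]
  ring

/-- **Stub piece `stub_siteExpansionRemainder`: the sitewise Cauchy–Born expansion, remainder (proved).**  With the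
Lennard-Jones bond gradient `k(v) = (−‖v‖⁻¹⁴ + ‖v‖⁻⁸)·v`, an actual configuration `x = y + u` and a region `Ω ∋ i` on
which every reference bond dominates its displacement (`‖u i − u j‖ ≤ ‖y i − y j‖/4`, `y j ≠ y i` for `j ∈ Ω ∖ i`):
`|e_i(x) − e_i(y) − ½ Σ_{j∈Ω∖i} ⟪k(y i − y j), u i − u j⟫| ≤ ½ Σ_{j∈Ω∖i} ‖u i − u j‖² (7281 ‖y i − y j‖⁻¹⁴ + 521 ‖y i − y j‖⁻⁸)`,
`e_i(z) = ½ Σ_{j∈Ω∖i} V(‖z i − z j‖)` (the landed one-bond bound `stub_ljPairTaylor`, summed). [folklore] -/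
theorem stub_siteExpansionRemainder :
    ∀ (N : ℕ) (Ω : Finset (Fin N)) (x y u : Fin N → EuclideanSpace ℝ (Fin 3)) (i : Fin N),
      (∀ j : Fin N, x j = y j + u j) →
      (∀ j ∈ Ω.erase i, y i - y j ≠ 0 ∧ ‖u i - u j‖ ≤ ‖y i - y j‖ / 4) →
        |(1 / 2 : ℝ) * (∑ j ∈ Ω.erase i, lennardJones ‖x i - x j‖) -
            (1 / 2 : ℝ) * (∑ j ∈ Ω.erase i, lennardJones ‖y i - y j‖) -
            (1 / 2 : ℝ) * (∑ j ∈ Ω.erase i,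
              inner ℝ ((-((‖y i - y j‖ ^ 2)⁻¹) ^ 7 + ((‖y i - y j‖ ^ 2)⁻¹) ^ 4) • (y i - y j)) (u i - u j))| ≤
          (1 / 2 : ℝ) * ∑ j ∈ Ω.erase i,
            ‖u i - u j‖ ^ 2 * (7281 * ((‖y i - y j‖ ^ 2)⁻¹) ^ 7 + 521 * ((‖y i - y j‖ ^ 2)⁻¹) ^ 4) := by
  intro N Ω x y u i hx hdom
  rw [← mul_sub, ← mul_sub, ← Finset.sum_sub_distrib, ← Finset.sum_sub_distrib, abs_mul,
    abs_of_pos (by norm_num : (0 : ℝ) < 1 / 2)]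
  refine mul_le_mul_of_nonneg_left ((Finset.abs_sum_le_sum_abs _ _).trans (Finset.sum_le_sum fun j hj => ?_))
    (by norm_num)
  obtain ⟨hne, hle⟩ := hdom j hj
  have hxij : x i - x j = (y i - y j) + (u i - u j) := by rw [hx i, hx j]; abel
  rw [hxij, real_inner_smul_left]
  exact stub_ljPairTaylor (y i - y j) (u i - u j) hne hle

/-- **Stub piece `stub_calibratedSiteExpansion`: sitewise Cauchy–Born expansion with exact first-order transfer
(proved).**  Under the hypotheses of `stub_siteExpansionRemainder`, with the transfer
`τ i j = ½⟪k(y i − y j), u i + u j⟫` of the Lennard-Jones bond gradient `k`: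
`e_i(x) + Σ_{j∈Ω} τ i j ≥ e_i(y) + ⟪F_i, u i⟫ − ½ Σ_{j∈Ω∖i} ‖u i − u j‖² (7281 ‖y i − y j‖⁻¹⁴ + 521 ‖y i − y j‖⁻⁸)`,
`F_i = Σ_{j∈Ω∖i} k(y i − y j)` the reference bond-force sum.  With `e_i(y) ≥ e* + κ r²` (Cauchy–Born floor and
landscape, CBBC), `F_i = 0` (force-balanced reference) and `‖u i − u j‖ ≤ 2ν_i` this is the LSC inequality at `i`.
[folklore] -/
theorem stub_calibratedSiteExpansion :
    ∀ (N : ℕ) (Ω : Finset (Fin N)) (x y u : Fin N → EuclideanSpace ℝ (Fin 3)) (i : Fin N), i ∈ Ω →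
      (∀ j : Fin N, x j = y j + u j) →
      (∀ j ∈ Ω.erase i, y i - y j ≠ 0 ∧ ‖u i - u j‖ ≤ ‖y i - y j‖ / 4) →
        (1 / 2 : ℝ) * (∑ j ∈ Ω.erase i, lennardJones ‖y i - y j‖) +
            inner ℝ (∑ j ∈ Ω.erase i, (-((‖y i - y j‖ ^ 2)⁻¹) ^ 7 + ((‖y i - y j‖ ^ 2)⁻¹) ^ 4) • (y i - y j)) (u i) -
            (1 / 2 : ℝ) * (∑ j ∈ Ω.erase i,
              ‖u i - u j‖ ^ 2 * (7281 * ((‖y i - y j‖ ^ 2)⁻¹) ^ 7 + 521 * ((‖y i - y j‖ ^ 2)⁻¹) ^ 4)) ≤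
          (1 / 2 : ℝ) * (∑ j ∈ Ω.erase i, lennardJones ‖x i - x j‖) +
            ∑ j ∈ Ω, (1 / 2 : ℝ) *
              inner ℝ ((-((‖y i - y j‖ ^ 2)⁻¹) ^ 7 + ((‖y i - y j‖ ^ 2)⁻¹) ^ 4) • (y i - y j)) (u i + u j) := by
  intro N Ω x y u i hi hx hdom
  -- the Lennard-Jones bond gradient is odd
  have hk : ∀ v : EuclideanSpace ℝ (Fin 3),
      (fun v : EuclideanSpace ℝ (Fin 3) => (-((‖v‖ ^ 2)⁻¹) ^ 7 + ((‖v‖ ^ 2)⁻¹) ^ 4) • v) (-v) =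
        -(fun v : EuclideanSpace ℝ (Fin 3) => (-((‖v‖ ^ 2)⁻¹) ^ 7 + ((‖v‖ ^ 2)⁻¹) ^ 4) • v) v := by
    intro v
    simp only [norm_neg, smul_neg]
  have hid := stub_linAddTransfer N
    (fun v : EuclideanSpace ℝ (Fin 3) => (-((‖v‖ ^ 2)⁻¹) ^ 7 + ((‖v‖ ^ 2)⁻¹) ^ 4) • v) hk Ω y u i hi
  have hrem := stub_siteExpansionRemainder N Ω x y u i hx hdom
  rw [← hid]
  have h := (abs_le.1 hrem).1
  linarith

/-- The Lennard-Jones bond gradient is dominated by `‖v‖⁻¹³ + ‖v‖⁻⁷`. [folklore] -/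
theorem norm_ljBondGrad_le (v : EuclideanSpace ℝ (Fin 3)) :
    ‖(-((‖v‖ ^ 2)⁻¹) ^ 7 + ((‖v‖ ^ 2)⁻¹) ^ 4) • v‖ ≤ ‖v‖⁻¹ ^ 13 + ‖v‖⁻¹ ^ 7 := by
  by_cases hv : v = 0
  · subst hv
    simp
  have hn : 0 < ‖v‖ := norm_pos_iff.2 hv
  have hX0 : 0 ≤ ‖v‖⁻¹ := inv_nonneg.2 hn.le
  rw [norm_smul, Real.norm_eq_abs, ← inv_pow, ← pow_mul, ← pow_mul]
  have h1 : |-(‖v‖⁻¹ ^ (2 * 7)) + ‖v‖⁻¹ ^ (2 * 4)| ≤ ‖v‖⁻¹ ^ (2 * 7) + ‖v‖⁻¹ ^ (2 * 4) := by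
    refine (abs_add_le _ _).trans ?_
    rw [abs_neg, abs_of_nonneg (pow_nonneg hX0 _), abs_of_nonneg (pow_nonneg hX0 _)]
  have h2 : (‖v‖⁻¹ ^ (2 * 7) + ‖v‖⁻¹ ^ (2 * 4)) * ‖v‖ = ‖v‖⁻¹ ^ 13 + ‖v‖⁻¹ ^ 7 := by
    have h3 : ‖v‖⁻¹ * ‖v‖ = 1 := inv_mul_cancel₀ hn.ne'
    calc (‖v‖⁻¹ ^ (2 * 7) + ‖v‖⁻¹ ^ (2 * 4)) * ‖v‖
        = (‖v‖⁻¹ ^ 13 + ‖v‖⁻¹ ^ 7) * (‖v‖⁻¹ * ‖v‖) := by ring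
      _ = ‖v‖⁻¹ ^ 13 + ‖v‖⁻¹ ^ 7 := by rw [h3, mul_one]
  calc |-(‖v‖⁻¹ ^ (2 * 7)) + ‖v‖⁻¹ ^ (2 * 4)| * ‖v‖ ≤ (‖v‖⁻¹ ^ (2 * 7) + ‖v‖⁻¹ ^ (2 * 4)) * ‖v‖ :=
        mul_le_mul_of_nonneg_right h1 hn.le
    _ = ‖v‖⁻¹ ^ 13 + ‖v‖⁻¹ ^ 7 := h2

/-- **Stub piece `stub_transferEnvelope` (proved).**  The first-order transfer of the Lennard-Jones bond gradient is
dominated by the reference bond and the gauge: `|τ i j| ≤ ½ (‖y i − y j‖⁻¹³ + ‖y i − y j‖⁻⁷)(‖u i‖ + ‖u j‖)`.  With a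
bounded gauge `‖u‖ ≤ U` and reference bonds `‖y i − y j‖ ≥ max δ (c‖x i − x j‖)` this is the `M·‖x i − x j‖⁻⁶`
envelope required by LSC. [folklore] -/
theorem stub_transferEnvelope :
    ∀ (N : ℕ) (y u : Fin N → EuclideanSpace ℝ (Fin 3)) (i j : Fin N),
      |(1 / 2 : ℝ) * inner ℝ ((-((‖y i - y j‖ ^ 2)⁻¹) ^ 7 + ((‖y i - y j‖ ^ 2)⁻¹) ^ 4) • (y i - y j)) (u i + u j)| ≤
        (1 / 2 : ℝ) * (‖y i - y j‖⁻¹ ^ 13 + ‖y i - y j‖⁻¹ ^ 7) * (‖u i‖ + ‖u j‖) := by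
  intro N y u i j
  rw [abs_mul, abs_of_pos (by norm_num : (0 : ℝ) < 1 / 2), mul_assoc]
  refine mul_le_mul_of_nonneg_left ?_ (by norm_num)
  calc |inner ℝ ((-((‖y i - y j‖ ^ 2)⁻¹) ^ 7 + ((‖y i - y j‖ ^ 2)⁻¹) ^ 4) • (y i - y j)) (u i + u j)|
      ≤ ‖(-((‖y i - y j‖ ^ 2)⁻¹) ^ 7 + ((‖y i - y j‖ ^ 2)⁻¹) ^ 4) • (y i - y j)‖ * ‖u i + u j‖ :=
        abs_real_inner_le_norm _ _
    _ ≤ (‖y i - y j‖⁻¹ ^ 13 + ‖y i - y j‖⁻¹ ^ 7) * (‖u i‖ + ‖u j‖) :=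
        mul_le_mul (norm_ljBondGrad_le _) (norm_add_le _ _) (norm_nonneg _) (by positivity)

/-- **Stub piece `stub_oddShellSum`: force balance of centrosymmetric reference shells (proved).**  An odd vector
function sums to zero over a finite set of bond vectors closed under `p ↦ −p` — e.g. the Lennard-Jones bond gradient
composed with any linear map, over a truncated template whose site set is centrosymmetric (every linear image of an
fcc shell): the reference bond-force sum `F_i` of `stub_linAddTransfer` vanishes there. [folklore] -/
theorem stub_oddShellSum :
    ∀ (S : Finset (EuclideanSpace ℝ (Fin 3))) (k : EuclideanSpace ℝ (Fin 3) → EuclideanSpace ℝ (Fin 3)),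
      (∀ v, k (-v) = -k v) → (∀ p ∈ S, -p ∈ S) → ∑ p ∈ S, k p = 0 := by
  intro S k hk hS
  have h : ∑ p ∈ S, k p = ∑ p ∈ S, k (-p) :=
    Finset.sum_nbij' (fun p => -p) (fun p => -p) (fun p hp => hS p hp) (fun p hp => hS p hp)
      (fun p _ => neg_neg p) (fun p _ => neg_neg p) (fun p _ => by rw [neg_neg])
  have h2 : ∑ p ∈ S, k (-p) = -∑ p ∈ S, k p := by
    rw [← Finset.sum_neg_distrib]
    exact Finset.sum_congr rfl fun p _ => hk p
  rw [h2] at h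
  have h3 : (2 : ℝ) • ∑ p ∈ S, k p = 0 := by
    rw [two_smul]
    nth_rewrite 2 [h]
    exact add_neg_cancel _
  exact (smul_eq_zero.1 h3).resolve_left two_ne_zero

end Summit.AtomisticToContinuum.Crystallization.Theorems.NashClassCertificatesNashNearField

end
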